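import Literature.Computability.Cryptography.ChenQuantumLWEDatumPrivacy
import Literature.Computability.Cryptography.ChenQuantumLWEClassTwirlSharp

/-!
# T10 is sharp: the public datum read-out of Chen's Step-9 register (T12)

REPRODUCTION / ANALYSIS OF A CLAIMED RESULT UNDER ADJUDICATION (withdrawn): Yilei Chen, *Quantum
Algorithms for Lattice Problems*, IACR ePrint 2024/555, version of 2024-04-18 [ChenQuantumLattice2024]
(the version carrying the author's note that Step 9 contains a bug), Step 9 (§3.5.9, pp. 34–38) acting
on `|φ8.b⟩ = Σ_{j ∈ ℤ_P} e(-j²/P) |2D²j·b + v′ mod N⟩` (p. 35), `P = p₁Q`, `N = D²P`.  Bundle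
`papers/QuantumAdvantage/lwe-quantum-autopsy/`, Part 2 (`REPAIR-CENSUS.md` §1 theorem **T12** and §19),
on top of `ChenQuantumLWEDatumPrivacy.lean` (T10: the class model `datumKet`, the bound
`datum_success_prob_le_of_prime`, the fibre count `card_ker_mul_Q`) and `ChenQuantumLWEClassTwirlSharp.lean`
(`lineFun_add`, `lineFun_single`).
HONEST FRAMING: kernel-checked THEOREMS about a state occurring in a WITHDRAWN algorithm — here the
EXACT VALUE of an information quantity (T10's ceiling is attained, so it is the optimum), i.e. a decidable
verdict completing a precise NEGATIVE result; NOT summit progress, no cryptanalytic claim in either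
direction, no new algorithm for any lattice problem; quantum lower bounds are out of scope.

## The question

T10 (`datum_success_prob_le_of_prime`): in the class model of one run — secrets `b + 2p₁(s·𝟙_U)`,
offsets `v′ + d(a,c)`, datum `a ∈ ℤ_Q` (the residue of `v′₀ mod D²P` that Step 9 consumes and Step 8 does
not certify) — EVERY measurement (POVM) of the Step-9 register `ℤ_N^{n+1}` guesses `a` with probability at
most `1/Q + (1 − 1/Q)/Q^m` for prime `Q`, `m = #U`.  Its docstring records sharpness as a by-hand remark
(bundle numerics `numerics/b2b-lwe-2/gen11_datum_privacy.py`; referee note N-30.2).  This file makes the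
remark a theorem: an EXPLICIT measurement, built from PUBLIC data only, attains the bound on every member
of the class, for every `Q`; for prime `Q` the bound is therefore the exact optimum.

## The measurement and what is proved

Public data: `n, D, p₁, Q`; the set `U` of unknown coordinates (`0 ∉ U` in Chen's eq. (12)); a public
vector `bk` agreeing with `b` off `U` and `≡ 0 (mod p₁)` on `U` (eq. (12): the unknown coordinates of `b`
are multiples of `2p₁`, so `bk = b` off `U`, `bk = 0` on `U` is public); a representative `v′` of the
offset class (the datum is read RELATIVE to it; every offset of the class is `v′ + d(a,c)`).
* `kerBlock` — the kernel block `B₀ = {u : u_i ≡ 0 (mod Q), i ∈ U}` of outcomes;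
  **`card_kerBlock_mul`**: `#B₀·Q^{#U} = N^{n+1}` (every `Q`).
* `twistKet a` — the twisted kets `w_a(u) = [u ∈ B₀]·ψ_Q(−a·λ(u))·QFT|φ8.bk,v′⟩(u)`,
  `λ(u) = ⟨bk, u mod P⟩ mod Q`; **`twistKet_orth`**: `⟨w_a|w_{a′}⟩ = [a = a′]·P·#B₀` as soon as some
  `bk_{i₀}`, `i₀ ∉ U`, is a unit mod `Q` (Chen: `bk₀ = −1`) — by the character sum
  **`kerBlock_charSum`** `Σ_{u ∈ B₀} ψ_Q(δ·λ(u)) = #B₀·[δ = 0]` (shift `u_{i₀}` by one).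
* **`datumKet_eq_twistKet`** (the mechanism): ON THE BLOCK every member ket of the class with datum `a`
  EQUALS `w_a` — the secret shift drops out of the line functional (`p₁·Q = 0` in `ℤ_P`, as in T4/T10),
  the `c`-part of the class-shift character is `1`, and the `a`-part is exactly the twist.  So on `B₀` the
  `Q` candidate data are `Q` mutually ORTHOGONAL states known to the measurer.
* `POVM.ofOrthogonal` (abstract): for pairwise orthogonal `w_a` of common norm `c`,
  `E_a = c⁻¹|w_a⟩⟨w_a| + |A|⁻¹(1 − Π)` is a POVM (`Π` the span projector, `spanProj`), and a ket aligned
  with `w_a` gets outcome `a` with weight `c + (‖ψ‖² − c)/|A|` (`POVM.ofOrthogonal_weight_of_aligned`).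
* **`datumReadout`** = that POVM for the twisted kets ("read `u mod Q` on `U`; on the kernel block
  discriminate the `Q` orthogonal candidates; elsewhere guess"), and **`datumReadout_weight`** (T12): on
  EVERY member `(a,(s,c))` it outputs `a` with Born weight exactly `(1/Q + (1 − 1/Q)/Q^{#U})·P·N^{n+1}`
  (odd `P`; the member's norm is `P·N^{n+1}`), hence (**`datum_success_prob_eq`**) class success
  probability exactly `1/Q + (1 − 1/Q)/Q^{#U}` — for every `Q`.
* Prime `Q`: **`datumReadout_optimal_of_prime`**, **`datum_success_prob_isGreatest_of_prime`** —
  `1/Q + (1 − 1/Q)/Q^{#U}` is the greatest class success probability over ALL POVMs (T10 is an equality;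
  Bayes value); **`datum_minimax_of_prime`** — no POVM exceeds `β·P·N^{n+1}` on every member (T10) and the
  read-out achieves it on every member (worst-case value `= β` too).
* `Shape.datum_privacy_attained`, `Shape.datum_privacy_sharp_of_prime` — the same for every admissible
  shape (C.3: `P` odd; eq. (12): `b₀ = −1`, `2p₁ ∣ b_i`), any `U ∌ 0`, any public `bk` as above.

Reading (census T12 / rows G1, G2, §6 item (4)): the single-run information content of the Step-9
register about the missing datum is now known EXACTLY for prime `Q`: advantage `(1 − 1/Q)·Q^{-m}` over
the blind guess, no more (T10) and no less (T12), achieved by a secret-ignorant measurement.  With `m ≥ 1`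
unknown coordinates this is `≤ pairsCount`-type `O(1/Q)`; it does not rescue Step 9 (T5: a wrong datum
gives a uniformly shifted, useless relation) — the value of T12 is that the ceiling of T10 is not an
artefact of the proof: nothing between `1/Q + (1 − 1/Q)Q^{-m}` and `1` is left to look for in this class.

## What is NOT here

The composite-`Q` optimum (`(1/Q)·E_u[gcd(ū|_U, Q)]` by hand — strictly between the value attained here
and T10's `1/Q + (1 − 1/Q)·π_B`; e.g. `Q = 15`, `m = 1`: `0.129 < 0.200 < 0.502`, bundle numerics); the
identification of the class shifts with all secret-ignorant side information (census §0, by hand, as in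
T10); measurements of earlier registers or of several runs (Part 1 (R), T11); any algorithm.

References: [ChenQuantumLattice2024] as above; [NielsenChuang2010] §2.2.6 (POVMs), Box 2.3 / §9.2
(discrimination of orthogonal states); [Korobov1992] Ch. I §§1, 3 (character sums, Gauss sums, via T3).
-/

namespace Literature.Computability.Cryptography.Chen2024

open scoped BigOperators ComplexOrder
open Matrix

/-! ### 1. The POVM of an orthogonal system of kets -/

section Orthogonal

variable {X A : Type*} [Fintype X] [Fintype A]

/-- `|w⟩⟨w|` applied to `ψ` is `⟨w|ψ⟩·|w⟩`. [folklore] -/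
theorem vecMulVec_star_mulVec (w ψ : X → ℂ) :
    vecMulVec w (star w) *ᵥ ψ = (star w ⬝ᵥ ψ) • w := by
  rw [vecMulVec_mulVec]
  ext x
  simp only [Pi.smul_apply, MulOpposite.smul_eq_mul_unop, MulOpposite.unop_op, smul_eq_mul, mul_comm]

/-- The (scaled) projector onto the span of a system `w : A → (X → ℂ)` of pairwise orthogonal kets of
common squared norm `c`: `Π = c⁻¹ Σ_a |w_a⟩⟨w_a|`. [folklore] -/
noncomputable def spanProj (w : A → X → ℂ) (c : ℝ) : Matrix X X ℂ :=
  ∑ a, ((c⁻¹ : ℝ) : ℂ) • vecMulVec (w a) (star (w a))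

omit [Fintype X] in
/-- `Π` is Hermitian. [folklore] -/
theorem spanProj_isHermitian (w : A → X → ℂ) (c : ℝ) : (spanProj w c).IsHermitian := by
  unfold spanProj
  rw [IsHermitian, conjTranspose_sum]
  refine Finset.sum_congr rfl fun a _ => ?_
  rw [conjTranspose_smul, conjTranspose_vecMulVec, star_star, Complex.star_def, Complex.conj_ofReal]

/-- `Π ψ = Σ_a c⁻¹⟨w_a|ψ⟩·w_a`. [folklore] -/
theorem spanProj_mulVec (w : A → X → ℂ) (c : ℝ) (ψ : X → ℂ) :
    spanProj w c *ᵥ ψ = ∑ a, (((c⁻¹ : ℝ) : ℂ) * (star (w a) ⬝ᵥ ψ)) • w a := by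
  unfold spanProj
  rw [sum_mulVec]
  refine Finset.sum_congr rfl fun a _ => ?_
  rw [smul_mulVec, vecMulVec_star_mulVec, smul_smul]

variable [DecidableEq A] {w : A → X → ℂ} {c : ℝ}

/-- A ket ALIGNED with the member `a` of the system (`⟨w_a′|ψ⟩ = [a′ = a]·c`) projects onto `w_a`:
`Π ψ = w_a`. [folklore] -/
theorem spanProj_mulVec_of_aligned (hc : 0 < c) {ψ : X → ℂ} {a : A}
    (hal : ∀ a', star (w a') ⬝ᵥ ψ = if a' = a then (c : ℂ) else 0) :
    spanProj w c *ᵥ ψ = w a := by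
  rw [spanProj_mulVec]
  have h : ∀ a', (((c⁻¹ : ℝ) : ℂ) * (star (w a') ⬝ᵥ ψ)) • w a' = if a' = a then w a else 0 := by
    intro a'
    rw [hal a']
    split_ifs with h
    · subst h
      rw [Complex.ofReal_inv, inv_mul_cancel₀ (by exact_mod_cast hc.ne'), one_smul]
    · rw [mul_zero, zero_smul]
  simp_rw [h]
  rw [Finset.sum_ite_eq' Finset.univ a, if_pos (Finset.mem_univ a)]

/-- On an orthogonal system, `Π w_a = w_a`. [folklore] -/
theorem spanProj_mulVec_self (hc : 0 < c)
    (horth : ∀ a a', star (w a) ⬝ᵥ w a' = if a = a' then (c : ℂ) else 0) (a : A) :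
    spanProj w c *ᵥ w a = w a :=
  spanProj_mulVec_of_aligned hc fun a' => horth a' a

/-- `Π² = Π` on an orthogonal system. [folklore] -/
theorem spanProj_mul_self (hc : 0 < c)
    (horth : ∀ a a', star (w a) ⬝ᵥ w a' = if a = a' then (c : ℂ) else 0) :
    spanProj w c * spanProj w c = spanProj w c := by
  have h : spanProj w c * spanProj w c
      = ∑ a, spanProj w c * (((c⁻¹ : ℝ) : ℂ) • vecMulVec (w a) (star (w a))) := by
    rw [← Matrix.mul_sum]
    rfl
  rw [h]
  conv_rhs => rw [spanProj]
  refine Finset.sum_congr rfl fun a _ => ?_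
  rw [Matrix.mul_smul, mul_vecMulVec, spanProj_mulVec_self hc horth a]

variable [DecidableEq X]

/-- `1 − Π` is positive semidefinite (a Hermitian idempotent). [folklore] -/
theorem posSemidef_one_sub_spanProj (hc : 0 < c)
    (horth : ∀ a a', star (w a) ⬝ᵥ w a' = if a = a' then (c : ℂ) else 0) :
    (1 - spanProj w c).PosSemidef := by
  have hH : (1 - spanProj w c)ᴴ = 1 - spanProj w c := by
    rw [conjTranspose_sub, conjTranspose_one, (spanProj_isHermitian w c).eq]
  have hI : (1 - spanProj w c) * (1 - spanProj w c) = 1 - spanProj w c := by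
    rw [sub_mul, one_mul, mul_sub, mul_one, spanProj_mul_self hc horth, sub_self, sub_zero]
  have h := posSemidef_conjTranspose_mul_self (1 - spanProj w c)
  rwa [hH, hI] at h

/-- **The POVM of an orthogonal system** `w : A → (X → ℂ)` (pairwise orthogonal, common squared norm
`c > 0`): `E_a = c⁻¹|w_a⟩⟨w_a| + |A|⁻¹(1 − Π)` — project onto `w_a`, and spread the orthogonal complement
of the span evenly (a blind guess there). [cite: NielsenChuang2010, §2.2.6 p. 90, Box 2.3 p. 87] -/
noncomputable def POVM.ofOrthogonal [Nonempty A] (w : A → X → ℂ) (c : ℝ) (hc : 0 < c)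
    (horth : ∀ a a', star (w a) ⬝ᵥ w a' = if a = a' then (c : ℂ) else 0) : POVM X A where
  effect a := ((c⁻¹ : ℝ) : ℂ) • vecMulVec (w a) (star (w a))
    + (((Fintype.card A : ℝ)⁻¹ : ℝ) : ℂ) • (1 - spanProj w c)
  posSemidef a :=
    ((posSemidef_vecMulVec_self_star (w a)).smul (Complex.zero_le_real.2 (inv_nonneg.2 hc.le))).add
      ((posSemidef_one_sub_spanProj hc horth).smul
        (Complex.zero_le_real.2 (inv_nonneg.2 (Nat.cast_nonneg _))))
  sum_eq_one := by
    have hA : (Fintype.card A : ℂ) ≠ 0 := by exact_mod_cast Fintype.card_ne_zero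
    have hk : (Fintype.card A : ℂ) * (((Fintype.card A : ℝ)⁻¹ : ℝ) : ℂ) = 1 := by
      rw [Complex.ofReal_inv, Complex.ofReal_natCast, mul_inv_cancel₀ hA]
    rw [Finset.sum_add_distrib, Finset.sum_const, Finset.card_univ, ← Nat.cast_smul_eq_nsmul ℂ,
      smul_smul, hk, one_smul]
    change spanProj w c + (1 - spanProj w c) = 1
    rw [add_sub_cancel]

/-- **Weight of an aligned ket.**  If `ψ` looks like `w_a` to the system (`⟨w_a′|ψ⟩ = [a′ = a]·c`), the
POVM of the system gives outcome `a` the weight `c + (‖ψ‖² − c)/|A|`: all of the aligned part, plus the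
blind share of the rest. [cite: NielsenChuang2010, §2.2.6 p. 90] -/
theorem POVM.ofOrthogonal_weight_of_aligned [Nonempty A] (hc : 0 < c)
    (horth : ∀ a a', star (w a) ⬝ᵥ w a' = if a = a' then (c : ℂ) else 0) {ψ : X → ℂ} {a : A}
    (hal : ∀ a', star (w a') ⬝ᵥ ψ = if a' = a then (c : ℂ) else 0) :
    (POVM.ofOrthogonal w c hc horth).weight ψ a
      = (c : ℂ) + (((Fintype.card A : ℝ)⁻¹ : ℝ) : ℂ) * (star ψ ⬝ᵥ ψ - c) := by
  have h1 : star ψ ⬝ᵥ w a = (c : ℂ) := by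
    rw [star_dotProduct, hal a, if_pos rfl, Complex.star_def, Complex.conj_ofReal]
  unfold POVM.weight POVM.ofOrthogonal
  dsimp only
  rw [add_mulVec, smul_mulVec, smul_mulVec, vecMulVec_star_mulVec, hal a, if_pos rfl, sub_mulVec,
    one_mulVec, spanProj_mulVec_of_aligned hc hal, dotProduct_add, dotProduct_smul, dotProduct_smul,
    dotProduct_smul, dotProduct_sub, h1, smul_eq_mul, smul_eq_mul, smul_eq_mul, Complex.ofReal_inv,
    ← mul_assoc, inv_mul_cancel₀ (by exact_mod_cast hc.ne'), one_mul]

end Orthogonal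

/-! ### 2. The kernel block of outcomes and its character sums -/

section KerBlock

variable (n : ℕ) (D p₁ Q : ℕ+)

/-- The KERNEL BLOCK of outcomes: `B₀ = {u : u_i ≡ 0 (mod Q) for every i ∈ U}` (for prime `Q` exactly
the non-generic outcomes of T10, `not_isGeneric_iff_of_prime`). [folklore] -/
def kerBlock (U : Finset (Fin (n + 1))) (u : Fin (n + 1) → ZN D p₁ Q) : Prop :=
  ∀ i, i ∈ U → toQ p₁ Q (toP D (p₁ * Q) (u i)) = 0

/-- Membership in the kernel block is decidable. [folklore] -/
instance kerBlock.instDecidable (U : Finset (Fin (n + 1))) (u : Fin (n + 1) → ZN D p₁ Q) :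
    Decidable (kerBlock n D p₁ Q U u) := by
  unfold kerBlock; infer_instance

/-- On the kernel block every class frequency vanishes. [folklore] -/
theorem classFreq_eq_zero_of_kerBlock {U : Finset (Fin (n + 1))} {u : Fin (n + 1) → ZN D p₁ Q}
    (hu : kerBlock n D p₁ Q U u) (i : Fin (n + 1)) : classFreq n D p₁ Q U u i = 0 := by
  unfold classFreq
  split_ifs with hi
  · exact hu i hi
  · rfl

/-- `0 ∈ B₀`. [folklore] -/
theorem kerBlock_zero (U : Finset (Fin (n + 1))) : kerBlock n D p₁ Q U 0 := fun i _ => by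
  rw [Pi.zero_apply, map_zero, map_zero]

/-- **Size of the kernel block**: `#B₀ · Q^{#U} = N^{n+1}` (every `Q`: each constrained coordinate has
`N/Q` residues `≡ 0 (mod Q)`). [folklore] -/
theorem card_kerBlock_mul (U : Finset (Fin (n + 1))) :
    Nat.card {u : Fin (n + 1) → ZN D p₁ Q // kerBlock n D p₁ Q U u} * ((Q : ℕ+) : ℕ) ^ U.card
      = ((D * D * (p₁ * Q) : ℕ+) : ℕ) ^ (n + 1) := by
  classical
  have h2 : Nat.card {u : Fin (n + 1) → ZN D p₁ Q // kerBlock n D p₁ Q U u}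
      = ∏ i : Fin (n + 1), Nat.card {x : ZN D p₁ Q // i ∈ U → toQ p₁ Q (toP D (p₁ * Q) x) = 0} := by
    unfold kerBlock
    rw [Nat.card_congr (@Equiv.subtypePiEquivPi (Fin (n + 1)) (fun _ => ZN D p₁ Q)
      (fun i x => i ∈ U → toQ p₁ Q (toP D (p₁ * Q) x) = 0)), Nat.card_pi]
  have h3 : ∀ i : Fin (n + 1),
      Nat.card {x : ZN D p₁ Q // i ∈ U → toQ p₁ Q (toP D (p₁ * Q) x) = 0}
        * (if i ∈ U then ((Q : ℕ+) : ℕ) else 1) = ((D * D * (p₁ * Q) : ℕ+) : ℕ) := by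
    intro i
    by_cases hi : i ∈ U
    · rw [if_pos hi, Nat.card_congr (Equiv.subtypeEquivRight (fun x => ⟨fun h => h hi, fun h _ => h⟩) :
        {x : ZN D p₁ Q // i ∈ U → toQ p₁ Q (toP D (p₁ * Q) x) = 0}
          ≃ {x : ZN D p₁ Q // toQ p₁ Q (toP D (p₁ * Q) x) = 0})]
      exact card_ker_mul_Q D p₁ Q
    · rw [if_neg hi, mul_one, Nat.card_congr (Equiv.subtypeUnivEquiv (fun x h => absurd h hi) :
        {x : ZN D p₁ Q // i ∈ U → toQ p₁ Q (toP D (p₁ * Q) x) = 0} ≃ ZN D p₁ Q),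
        Nat.card_eq_fintype_card, ZMod.card]
  have h4 : ((Q : ℕ+) : ℕ) ^ U.card = ∏ i : Fin (n + 1), (if i ∈ U then ((Q : ℕ+) : ℕ) else 1) := by
    rw [Finset.prod_ite_mem, Finset.univ_inter, Finset.prod_const]
  rw [h2, h4, ← Finset.prod_mul_distrib, Finset.prod_congr rfl fun i _ => h3 i, Finset.prod_const,
    Finset.card_univ, Fintype.card_fin]

/-- `#B₀ > 0`. [folklore] -/
theorem card_kerBlock_pos (U : Finset (Fin (n + 1))) :
    0 < Nat.card {u : Fin (n + 1) → ZN D p₁ Q // kerBlock n D p₁ Q U u} := by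
  have h := card_kerBlock_mul n D p₁ Q U
  refine Nat.pos_of_ne_zero fun h0 => ?_
  rw [h0, zero_mul] at h
  exact (pow_pos (PNat.pos _) _).ne' h.symm

/-- Shifting the free coordinate `i₀ ∉ U` does not move the kernel block. [folklore] -/
theorem kerBlock_add_single_iff (U : Finset (Fin (n + 1))) {i₀ : Fin (n + 1)} (hi₀ : i₀ ∉ U)
    (u : Fin (n + 1) → ZN D p₁ Q) :
    kerBlock n D p₁ Q U (u + Pi.single i₀ 1) ↔ kerBlock n D p₁ Q U u := by
  unfold kerBlock
  refine forall₂_congr fun i hi => ?_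
  have hne : i ≠ i₀ := fun h => hi₀ (h ▸ hi)
  rw [Pi.add_apply, Pi.single_eq_of_ne hne, add_zero]

/-- **Character sum over the kernel block.**  With `λ(u) = ⟨bk, u mod P⟩ mod Q` and some coordinate
`i₀ ∉ U` where `bk_{i₀}` is a unit mod `Q` (Chen: `bk₀ = −1`, `0 ∉ U`):
`Σ_{u ∈ B₀} ψ_Q(δ·λ(u)) = #B₀·[δ = 0]` — shifting `u_{i₀}` by one multiplies the sum by `ψ_Q(δ·bk_{i₀}) ≠ 1`.
[cite: Korobov1992, Ch. I §1 (orthogonality of characters)] -/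
theorem kerBlock_charSum (U : Finset (Fin (n + 1))) (bk : Fin (n + 1) → ℤ)
    (hunit : ∃ i₀, i₀ ∉ U ∧ IsUnit ((bk i₀ : ℤ) : ZQ Q)) (δ : ZQ Q) :
    ∑ u : Fin (n + 1) → ZN D p₁ Q,
        (if kerBlock n D p₁ Q U u
          then (ZMod.stdAddChar (δ * toQ p₁ Q (lineFun n D p₁ Q bk u)) : ℂ) else 0)
      = if δ = 0 then (Nat.card {u : Fin (n + 1) → ZN D p₁ Q // kerBlock n D p₁ Q U u} : ℂ) else 0 := by
  split_ifs with hδ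
  · subst hδ
    simp only [zero_mul, AddChar.map_zero_eq_one]
    rw [Finset.sum_boole, ← Fintype.card_subtype, ← Nat.card_eq_fintype_card]
  · obtain ⟨i₀, hi₀, hu⟩ := hunit
    set z : Fin (n + 1) → ZN D p₁ Q := Pi.single i₀ 1 with hz
    set F : (Fin (n + 1) → ZN D p₁ Q) → ℂ := fun u =>
      if kerBlock n D p₁ Q U u then (ZMod.stdAddChar (δ * toQ p₁ Q (lineFun n D p₁ Q bk u)) : ℂ) else 0
      with hF
    have hshift : ∀ u, F (u + z) = ZMod.stdAddChar (δ * ((bk i₀ : ℤ) : ZQ Q)) * F u := by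
      intro u
      simp only [hF, hz, kerBlock_add_single_iff n D p₁ Q U hi₀]
      split_ifs with hu'
      · rw [lineFun_add, lineFun_single, map_one, mul_one, map_add, map_intCast, mul_add,
          AddChar.map_add_eq_mul, mul_comm]
      · rw [mul_zero]
    have hsum : ∑ u, F u = ZMod.stdAddChar (δ * ((bk i₀ : ℤ) : ZQ Q)) * ∑ u, F u := by
      rw [Finset.mul_sum]
      simp_rw [← hshift]
      exact (Fintype.sum_equiv (Equiv.addRight z) (fun u => F (u + z)) F fun u => rfl).symm
    have hne : (ZMod.stdAddChar (δ * ((bk i₀ : ℤ) : ZQ Q)) : ℂ) ≠ 1 := fun h1 =>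
      hδ ((hu.mul_left_eq_zero).1 (((ZMod.isPrimitive_stdAddChar _).zmod_char_eq_one_iff _ _).1 h1))
    exact eq_zero_of_mul_eq_self_left hne hsum.symm

end KerBlock

/-! ### 3. The public twisted kets; T12 -/

section Readout

variable (n : ℕ) (D p₁ Q : ℕ+)

/-- **The public twisted kets.**  `w_a(u) = [u ∈ B₀]·ψ_Q(−a·λ(u))·QFT|φ8.bk, v′⟩(u)`, built from PUBLIC
data only: the unknown-coordinate set `U`, the public vector `bk` (eq. (12): `b` with its unknown
coordinates replaced by multiples of `p₁`, e.g. zeros), a representative `v′` of the offset class, and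
`λ(u) = ⟨bk, u mod P⟩ mod Q`. [cite: ChenQuantumLattice2024, §3.5.9 p. 35, eq. (12) p. 17] -/
noncomputable def twistKet (U : Finset (Fin (n + 1))) (bk v' : Fin (n + 1) → ℤ) (a : ZQ Q)
    (u : Fin (n + 1) → ZN D p₁ Q) : ℂ :=
  if kerBlock n D p₁ Q U u then
    (ZMod.stdAddChar (-(a * toQ p₁ Q (lineFun n D p₁ Q bk u))) : ℂ) * qft (phi8bKet n D p₁ Q bk v') u
  else 0

/-- `c₀ = P·#B₀`, the common squared norm of the twisted kets (odd `P`). [folklore] -/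
noncomputable def blockNorm (U : Finset (Fin (n + 1))) : ℝ :=
  (((p₁ * Q : ℕ+) : ℕ) : ℝ) * (Nat.card {u : Fin (n + 1) → ZN D p₁ Q // kerBlock n D p₁ Q U u} : ℝ)

/-- `c₀ > 0`. [folklore] -/
theorem blockNorm_pos (U : Finset (Fin (n + 1))) : 0 < blockNorm n D p₁ Q U := by
  unfold blockNorm
  have h1 : (0 : ℝ) < (((p₁ * Q : ℕ+) : ℕ) : ℝ) := by exact_mod_cast PNat.pos _
  have h2 : (0 : ℝ) < (Nat.card {u : Fin (n + 1) → ZN D p₁ Q // kerBlock n D p₁ Q U u} : ℝ) := by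
    exact_mod_cast card_kerBlock_pos n D p₁ Q U
  exact mul_pos h1 h2

/-- The entrywise product behind the overlaps: on `B₀`,
`conj w_a(u) · w_{a′}(u) = ψ_Q((a − a′)·λ(u)) · P` (flat spectrum `|QFT|φ8⟩(u)|² = P`, T3).
[cite: ChenQuantumLattice2024, §3.5.9 p. 35; Korobov1992, Ch. I §3 Thm 3] -/
theorem star_twistKet_mul_twistKet (hP : Odd ((p₁ * Q : ℕ+) : ℕ)) (U : Finset (Fin (n + 1)))
    (bk v' : Fin (n + 1) → ℤ) (a a' : ZQ Q) (u : Fin (n + 1) → ZN D p₁ Q) :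
    star (twistKet n D p₁ Q U bk v' a u) * twistKet n D p₁ Q U bk v' a' u
      = if kerBlock n D p₁ Q U u
        then (ZMod.stdAddChar ((a - a') * toQ p₁ Q (lineFun n D p₁ Q bk u)) : ℂ) * (((p₁ * Q : ℕ+) : ℕ) : ℂ)
        else 0 := by
  unfold twistKet
  split_ifs with hu
  · rw [Complex.star_def, map_mul, ← AddChar.map_neg_eq_conj, neg_neg, mul_mul_mul_comm,
      ← AddChar.map_add_eq_mul, mul_comm ((starRingEnd ℂ) _), ← fourierGram, fourierGram_self n D p₁ Q hP]
    congr 2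
    ring
  · rw [star_zero, zero_mul]

/-- **Orthogonality of the twisted kets**: `⟨w_a|w_{a′}⟩ = [a = a′]·P·#B₀`, provided some coordinate
`i₀ ∉ U` has `bk_{i₀}` a unit mod `Q`. [cite: ChenQuantumLattice2024, §3.5.9 p. 35, eq. (12) p. 17] -/
theorem twistKet_orth (hP : Odd ((p₁ * Q : ℕ+) : ℕ)) (U : Finset (Fin (n + 1)))
    (bk v' : Fin (n + 1) → ℤ) (hunit : ∃ i₀, i₀ ∉ U ∧ IsUnit ((bk i₀ : ℤ) : ZQ Q)) (a a' : ZQ Q) :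
    star (twistKet n D p₁ Q U bk v' a) ⬝ᵥ twistKet n D p₁ Q U bk v' a'
      = if a = a' then ((blockNorm n D p₁ Q U : ℝ) : ℂ) else 0 := by
  unfold dotProduct
  simp only [Pi.star_apply, star_twistKet_mul_twistKet n D p₁ Q hP]
  have h : ∀ u : Fin (n + 1) → ZN D p₁ Q,
      (if kerBlock n D p₁ Q U u
        then (ZMod.stdAddChar ((a - a') * toQ p₁ Q (lineFun n D p₁ Q bk u)) : ℂ) * (((p₁ * Q : ℕ+) : ℕ) : ℂ)
        else 0)
      = (((p₁ * Q : ℕ+) : ℕ) : ℂ) * (if kerBlock n D p₁ Q U u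
        then (ZMod.stdAddChar ((a - a') * toQ p₁ Q (lineFun n D p₁ Q bk u)) : ℂ) else 0) := by
    intro u
    split_ifs
    · rw [mul_comm]
    · rw [mul_zero]
  simp_rw [h]
  rw [← Finset.mul_sum, kerBlock_charSum n D p₁ Q U bk hunit (a - a')]
  unfold blockNorm
  by_cases haa : a = a'
  · subst haa
    rw [if_pos (sub_self a), if_pos rfl]
    push_cast
    ring
  · rw [if_neg (sub_ne_zero.2 haa), if_neg haa, mul_zero]

/-- **The member kets coincide with the twisted kets on the kernel block.**  For the class member with
datum `a`, secret shift `s` and offset shift `c`: on `u ∈ B₀` the secret shift drops out of the line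
functional (`p₁·Q = 0`), the `c`-part of the class-shift character is `1`, and the `a`-part is the twist
`ψ_Q(−a·λ(u))` — so `QFT|φ8.(b+2p₁s𝟙_U), v′+d(a,c)⟩(u) = w_a(u)`, whenever `b` and `bk` agree off `U` and
are `≡ 0 (mod p₁)` on `U` (eq. (12)). [cite: ChenQuantumLattice2024, §3.5.9 pp. 35–37, eq. (12) p. 17] -/
theorem datumKet_eq_twistKet (U : Finset (Fin (n + 1))) (bk b v' : Fin (n + 1) → ℤ)
    (hb : ∀ i ∈ U, ((p₁ : ℕ) : ℤ) ∣ b i) (hbkU : ∀ i ∈ U, ((p₁ : ℕ) : ℤ) ∣ bk i)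
    (hbk : ∀ i, i ∉ U → bk i = b i) (a : ZQ Q)
    (sc : (Fin (n + 1) → ZQ Q) × (Fin (n + 1) → ZQ Q)) {u : Fin (n + 1) → ZN D p₁ Q}
    (hu : kerBlock n D p₁ Q U u) :
    datumKet n D p₁ Q U bk b v' a sc u = twistKet n D p₁ Q U bk v' a u := by
  unfold datumKet twistKet
  have hline : lineFun n D p₁ Q (b + secretShift n p₁ Q U sc.1) u = lineFun n D p₁ Q bk u := by
    rw [lineFun_add_secretShift, mul_left_comm,
      p₁_mul_tailLin_eq_zero n D p₁ Q U sc.1 u (fun i _ => classFreq_eq_zero_of_kerBlock n D p₁ Q hu i),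
      mul_zero, add_zero]
    exact lineFun_eq_of_agree n D p₁ Q U b bk hb hbkU (fun i hi => (hbk i hi).symm) u hu
  have hchar : (ZMod.stdAddChar (-offsetFun n D p₁ Q (classShift n D p₁ Q U bk a sc.2) u) : ℂ)
      = ZMod.stdAddChar (-(a * toQ p₁ Q (lineFun n D p₁ Q bk u))) := by
    rw [AddChar.map_neg_eq_conj, AddChar.map_neg_eq_conj, stdAddChar_offsetFun_classShift,
      Finset.prod_eq_one (fun i _ => by
        rw [classFreq_eq_zero_of_kerBlock n D p₁ Q hu i, mul_zero, AddChar.map_zero_eq_one]), mul_one]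
  rw [if_pos hu, qft_phi8bKet_eq_lineGauss, qft_phi8bKet_eq_lineGauss, offsetFun_add, neg_add,
    AddChar.map_add_eq_mul, hchar, hline]
  ring

/-- Off the kernel block the twisted kets vanish, so a member ket with datum `a` has the same overlaps
with the system as `w_a` itself: `⟨w_{a′}|member⟩ = [a′ = a]·P·#B₀`. [folklore] -/
theorem twistKet_dot_datumKet (hP : Odd ((p₁ * Q : ℕ+) : ℕ)) (U : Finset (Fin (n + 1)))
    (bk b v' : Fin (n + 1) → ℤ)
    (hb : ∀ i ∈ U, ((p₁ : ℕ) : ℤ) ∣ b i) (hbkU : ∀ i ∈ U, ((p₁ : ℕ) : ℤ) ∣ bk i)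
    (hbk : ∀ i, i ∉ U → bk i = b i) (hunit : ∃ i₀, i₀ ∉ U ∧ IsUnit ((bk i₀ : ℤ) : ZQ Q))
    (a a' : ZQ Q) (sc : (Fin (n + 1) → ZQ Q) × (Fin (n + 1) → ZQ Q)) :
    star (twistKet n D p₁ Q U bk v' a') ⬝ᵥ datumKet n D p₁ Q U bk b v' a sc
      = if a' = a then ((blockNorm n D p₁ Q U : ℝ) : ℂ) else 0 := by
  rw [← twistKet_orth n D p₁ Q hP U bk v' hunit a' a]
  unfold dotProduct
  refine Finset.sum_congr rfl fun u _ => ?_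
  by_cases hu : kerBlock n D p₁ Q U u
  · rw [datumKet_eq_twistKet n D p₁ Q U bk b v' hb hbkU hbk a sc hu]
  · simp only [Pi.star_apply, twistKet, if_neg hu, star_zero, zero_mul]

/-- Every member ket has squared norm `P·N^{n+1}` (flat spectrum, T3). [cite: ChenQuantumLattice2024, §3.5.9 p. 35] -/
theorem datumKet_normSq (hP : Odd ((p₁ * Q : ℕ+) : ℕ)) (U : Finset (Fin (n + 1)))
    (bk b v' : Fin (n + 1) → ℤ) (a : ZQ Q) (sc : (Fin (n + 1) → ZQ Q) × (Fin (n + 1) → ZQ Q)) :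
    star (datumKet n D p₁ Q U bk b v' a sc) ⬝ᵥ datumKet n D p₁ Q U bk b v' a sc
      = (((((p₁ * Q : ℕ+) : ℕ)) * ((D * D * (p₁ * Q) : ℕ+) : ℕ) ^ (n + 1) : ℕ) : ℂ) := by
  have hdiag : star (datumKet n D p₁ Q U bk b v' a sc) ⬝ᵥ datumKet n D p₁ Q U bk b v' a sc
      = ∑ u : Fin (n + 1) → ZN D p₁ Q, ((((p₁ * Q : ℕ+) : ℕ) : ℂ)) := by
    simp only [dotProduct, Pi.star_apply, Complex.star_def]
    refine Finset.sum_congr rfl fun u _ => ?_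
    rw [mul_comm]
    exact fourierGram_self n D p₁ Q hP _ _ u
  rw [hdiag, Finset.sum_const, Finset.card_univ, Fintype.card_fun, ZMod.card, Fintype.card_fin, nsmul_eq_mul]
  push_cast
  ring

/-- **The datum read-out** — the POVM of T12 on the Step-9 register `ℤ_N^{n+1}`, outcomes in `ℤ_Q`:
`E_a = c₀⁻¹|w_a⟩⟨w_a| + Q⁻¹(1 − Π)`, `Π` the projector onto the span of the twisted kets (`c₀ = P·#B₀`).
In words: read `ū = u mod Q` on `U`; on the kernel block `ū|_U = 0` discriminate the `Q` orthogonal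
twisted states (which there ARE the `Q` candidate states); elsewhere guess blindly.  Built from public
data `(U, bk, v′)` only. [cite: ChenQuantumLattice2024, §3.5.9 pp. 35–37; NielsenChuang2010, Box 2.3 p. 87] -/
noncomputable def datumReadout (hP : Odd ((p₁ * Q : ℕ+) : ℕ)) (U : Finset (Fin (n + 1)))
    (bk v' : Fin (n + 1) → ℤ) (hunit : ∃ i₀, i₀ ∉ U ∧ IsUnit ((bk i₀ : ℤ) : ZQ Q)) :
    POVM (Fin (n + 1) → ZN D p₁ Q) (ZQ Q) :=
  POVM.ofOrthogonal (twistKet n D p₁ Q U bk v') (blockNorm n D p₁ Q U) (blockNorm_pos n D p₁ Q U)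
    (twistKet_orth n D p₁ Q hP U bk v' hunit)

/-- **T12 (the datum read-out attains the bound on EVERY member).**  For odd `P`, `b ≡ bk` off `U`,
`b ≡ bk ≡ 0 (mod p₁)` on `U`, and a unit coordinate `bk_{i₀}`, `i₀ ∉ U`: for EVERY datum `a`, secret
shift `s` and offset shift `c`, the datum read-out outputs `a` on the member `(a,(s,c))` with Born weight
EXACTLY `(1/Q + (1 − 1/Q)/Q^{#U})·P·N^{n+1}` — the fraction `1/Q + (1 − 1/Q)/Q^{#U}` of the member's
norm `P·N^{n+1}`, the same on every instance of the class (no worst case).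
[cite: ChenQuantumLattice2024, §3.5.9 pp. 35–37, eq. (12) p. 17; NielsenChuang2010, Box 2.3 p. 87] -/
theorem datumReadout_weight (hP : Odd ((p₁ * Q : ℕ+) : ℕ)) (U : Finset (Fin (n + 1)))
    (bk b v' : Fin (n + 1) → ℤ)
    (hb : ∀ i ∈ U, ((p₁ : ℕ) : ℤ) ∣ b i) (hbkU : ∀ i ∈ U, ((p₁ : ℕ) : ℤ) ∣ bk i)
    (hbk : ∀ i, i ∉ U → bk i = b i) (hunit : ∃ i₀, i₀ ∉ U ∧ IsUnit ((bk i₀ : ℤ) : ZQ Q))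
    (a : ZQ Q) (sc : (Fin (n + 1) → ZQ Q) × (Fin (n + 1) → ZQ Q)) :
    (datumReadout n D p₁ Q hP U bk v' hunit).weight (datumKet n D p₁ Q U bk b v' a sc) a
      = (((1 / ((Q : ℕ+) : ℕ) + (1 - 1 / ((Q : ℕ+) : ℕ)) / (((Q : ℕ+) : ℕ) : ℝ) ^ U.card)
          * ((((p₁ * Q : ℕ+) : ℕ) : ℝ) * (((D * D * (p₁ * Q) : ℕ+) : ℕ) : ℝ) ^ (n + 1)) : ℝ) : ℂ) := by
  unfold datumReadout
  rw [POVM.ofOrthogonal_weight_of_aligned (blockNorm_pos n D p₁ Q U) (twistKet_orth n D p₁ Q hP U bk v' hunit)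
      (fun a' => twistKet_dot_datumKet n D p₁ Q hP U bk b v' hb hbkU hbk hunit a a' sc),
    datumKet_normSq n D p₁ Q hP, ZMod.card]
  unfold blockNorm
  have hc := card_kerBlock_mul n D p₁ Q U
  set B : ℕ := Nat.card {u : Fin (n + 1) → ZN D p₁ Q // kerBlock n D p₁ Q U u} with hB
  have hN : (((D * D * (p₁ * Q) : ℕ+) : ℕ) : ℝ) ^ (n + 1) = (B : ℝ) * (((Q : ℕ+) : ℕ) : ℝ) ^ U.card := by
    exact_mod_cast hc.symm
  have hQ : (0 : ℝ) < ((Q : ℕ+) : ℕ) := by exact_mod_cast PNat.pos Q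
  rw [← Complex.ofReal_natCast, ← Complex.ofReal_sub, ← Complex.ofReal_mul, ← Complex.ofReal_add]
  congr 1
  rw [Nat.cast_mul, Nat.cast_pow, hN]
  field_simp
  ring

/-! ### 4. Probability form; prime `Q`: T10 is sharp -/


/-- **T12 (probability form, every `Q`).**  Normalising by the total weight of the class
(`datum_totalWeight`): with the datum `a`, the secret shift `s` and the offset shift `c` uniform, the
datum read-out guesses `a` correctly with probability EXACTLY `1/Q + (1 − 1/Q)/Q^{#U}`
(`#B₀·Q^{#U} = N^{n+1}`).  For prime `Q` this is T10's upper bound `datum_success_prob_le_of_prime`;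
for composite `Q` it lies strictly below T10's bound `1/Q + (1 − 1/Q)·π_B` in general (the true optimum,
`(1/Q)·E_u[gcd(ū|_U, Q)]` by hand, is not formalised). [cite: ChenQuantumLattice2024, §3.5.9 pp. 35–37] -/
theorem datum_success_prob_eq (hP : Odd ((p₁ * Q : ℕ+) : ℕ)) (U : Finset (Fin (n + 1)))
    (bk b v' : Fin (n + 1) → ℤ)
    (hb : ∀ i ∈ U, ((p₁ : ℕ) : ℤ) ∣ b i) (hbkU : ∀ i ∈ U, ((p₁ : ℕ) : ℤ) ∣ bk i)
    (hbk : ∀ i, i ∉ U → bk i = b i) (hunit : ∃ i₀, i₀ ∉ U ∧ IsUnit ((bk i₀ : ℤ) : ZQ Q)) :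
    (∑ a, ∑ sc, (datumReadout n D p₁ Q hP U bk v' hunit).weight (datumKet n D p₁ Q U bk b v' a sc) a).re
        / (∑ a : ZQ Q, ∑ sc,
            star (datumKet n D p₁ Q U bk b v' a sc) ⬝ᵥ datumKet n D p₁ Q U bk b v' a sc).re
      = 1 / ((Q : ℕ+) : ℕ) + (1 - 1 / ((Q : ℕ+) : ℕ)) / (((Q : ℕ+) : ℕ) : ℝ) ^ U.card := by
  simp only [datumReadout_weight n D p₁ Q hP U bk b v' hb hbkU hbk hunit]
  rw [Finset.sum_const, Finset.card_univ, Finset.sum_const, Finset.card_univ, smul_smul, nsmul_eq_mul,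
    ← Complex.ofReal_natCast, ← Complex.ofReal_mul, Complex.ofReal_re, datum_totalWeight n D p₁ Q hP,
    Complex.natCast_re]
  simp only [Fintype.card_prod, Fintype.card_fun, ZMod.card, Fintype.card_fin]
  have hQ : (0 : ℝ) < ((Q : ℕ+) : ℕ) := by exact_mod_cast PNat.pos Q
  have hP' : (0 : ℝ) < ((p₁ * Q : ℕ+) : ℕ) := by exact_mod_cast PNat.pos _
  have hN : (0 : ℝ) < ((D * D * (p₁ * Q) : ℕ+) : ℕ) := by exact_mod_cast PNat.pos _
  rw [div_eq_iff (by positivity)]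
  push_cast
  ring

/-- **T12 ⇒ T10 is sharp for prime `Q`.**  The class success probability of ANY measurement of the Step-9
register is at most that of the datum read-out: `1/Q + (1 − 1/Q)/Q^{#U}` is the exact optimum over all
POVMs (minimax = Bayes value; T10's inequality is an equality). [cite: ChenQuantumLattice2024, §3.5.9 pp. 35–37;
NielsenChuang2010, Box 2.3 p. 87] -/
theorem datumReadout_optimal_of_prime [Fact (Nat.Prime ((Q : ℕ+) : ℕ))]
    (hP : Odd ((p₁ * Q : ℕ+) : ℕ)) (U : Finset (Fin (n + 1))) (bk b v' : Fin (n + 1) → ℤ)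
    (hb : ∀ i ∈ U, ((p₁ : ℕ) : ℤ) ∣ b i) (hbkU : ∀ i ∈ U, ((p₁ : ℕ) : ℤ) ∣ bk i)
    (hbk : ∀ i, i ∉ U → bk i = b i) (hunit : ∃ i₀, i₀ ∉ U ∧ IsUnit ((bk i₀ : ℤ) : ZQ Q))
    (E : POVM (Fin (n + 1) → ZN D p₁ Q) (ZQ Q)) :
    (∑ a, ∑ sc, E.weight (datumKet n D p₁ Q U bk b v' a sc) a).re
        / (∑ a : ZQ Q, ∑ sc,
            star (datumKet n D p₁ Q U bk b v' a sc) ⬝ᵥ datumKet n D p₁ Q U bk b v' a sc).re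
      ≤ (∑ a, ∑ sc, (datumReadout n D p₁ Q hP U bk v' hunit).weight (datumKet n D p₁ Q U bk b v' a sc) a).re
        / (∑ a : ZQ Q, ∑ sc,
            star (datumKet n D p₁ Q U bk b v' a sc) ⬝ᵥ datumKet n D p₁ Q U bk b v' a sc).re := by
  rw [datum_success_prob_eq n D p₁ Q hP U bk b v' hb hbkU hbk hunit]
  exact datum_success_prob_le_of_prime n D p₁ Q hP U bk b v' hbk E

/-- **The optimum, prime `Q`.**  `1/Q + (1 − 1/Q)/Q^{#U}` is the GREATEST class success probability over all
POVMs on the Step-9 register (attained: the datum read-out; upper bound: T10).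
[cite: ChenQuantumLattice2024, §3.5.9 pp. 35–37; NielsenChuang2010, Box 2.3 p. 87] -/
theorem datum_success_prob_isGreatest_of_prime [Fact (Nat.Prime ((Q : ℕ+) : ℕ))]
    (hP : Odd ((p₁ * Q : ℕ+) : ℕ)) (U : Finset (Fin (n + 1))) (bk b v' : Fin (n + 1) → ℤ)
    (hb : ∀ i ∈ U, ((p₁ : ℕ) : ℤ) ∣ b i) (hbkU : ∀ i ∈ U, ((p₁ : ℕ) : ℤ) ∣ bk i)
    (hbk : ∀ i, i ∉ U → bk i = b i) (hunit : ∃ i₀, i₀ ∉ U ∧ IsUnit ((bk i₀ : ℤ) : ZQ Q)) :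
    IsGreatest (Set.range fun E : POVM (Fin (n + 1) → ZN D p₁ Q) (ZQ Q) =>
        (∑ a, ∑ sc, E.weight (datumKet n D p₁ Q U bk b v' a sc) a).re
          / (∑ a : ZQ Q, ∑ sc,
              star (datumKet n D p₁ Q U bk b v' a sc) ⬝ᵥ datumKet n D p₁ Q U bk b v' a sc).re)
      (1 / ((Q : ℕ+) : ℕ) + (1 - 1 / ((Q : ℕ+) : ℕ)) / (((Q : ℕ+) : ℕ) : ℝ) ^ U.card) := by
  refine ⟨⟨datumReadout n D p₁ Q hP U bk v' hunit, datum_success_prob_eq n D p₁ Q hP U bk b v' hb hbkU hbk hunit⟩, ?_⟩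
  rintro _ ⟨E, rfl⟩
  exact datum_success_prob_le_of_prime n D p₁ Q hP U bk b v' hbk E

/-- **Minimax, prime `Q` (worst case over the class).**  No measurement outputs the datum with weight above
`β·P·N^{n+1}` on EVERY member (T10, `datum_exists_member_le`), `β = 1/Q + (1 − 1/Q)/Q^{#U}`, and the datum
read-out achieves exactly `β·P·N^{n+1}` on every member (T12): the worst-case value over all POVMs is `β`.
[cite: ChenQuantumLattice2024, §3.5.9 pp. 35–37] -/
theorem datum_minimax_of_prime [Fact (Nat.Prime ((Q : ℕ+) : ℕ))]
    (hP : Odd ((p₁ * Q : ℕ+) : ℕ)) (U : Finset (Fin (n + 1))) (bk b v' : Fin (n + 1) → ℤ)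
    (hb : ∀ i ∈ U, ((p₁ : ℕ) : ℤ) ∣ b i) (hbkU : ∀ i ∈ U, ((p₁ : ℕ) : ℤ) ∣ bk i)
    (hbk : ∀ i, i ∉ U → bk i = b i) (hunit : ∃ i₀, i₀ ∉ U ∧ IsUnit ((bk i₀ : ℤ) : ZQ Q)) :
    (∀ E : POVM (Fin (n + 1) → ZN D p₁ Q) (ZQ Q), ∃ a : ZQ Q,
        ∃ sc : (Fin (n + 1) → ZQ Q) × (Fin (n + 1) → ZQ Q),
          (E.weight (datumKet n D p₁ Q U bk b v' a sc) a).re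
            ≤ (1 / ((Q : ℕ+) : ℕ) + (1 - 1 / ((Q : ℕ+) : ℕ)) / (((Q : ℕ+) : ℕ) : ℝ) ^ U.card)
              * ((((p₁ * Q : ℕ+) : ℕ) : ℝ) * (((D * D * (p₁ * Q) : ℕ+) : ℕ) : ℝ) ^ (n + 1)))
    ∧ (∀ a : ZQ Q, ∀ sc : (Fin (n + 1) → ZQ Q) × (Fin (n + 1) → ZQ Q),
        ((datumReadout n D p₁ Q hP U bk v' hunit).weight (datumKet n D p₁ Q U bk b v' a sc) a).re
          = (1 / ((Q : ℕ+) : ℕ) + (1 - 1 / ((Q : ℕ+) : ℕ)) / (((Q : ℕ+) : ℕ) : ℝ) ^ U.card)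
              * ((((p₁ * Q : ℕ+) : ℕ) : ℝ) * (((D * D * (p₁ * Q) : ℕ+) : ℕ) : ℝ) ^ (n + 1))) := by
  refine ⟨fun E => ?_, fun a sc => ?_⟩
  · obtain ⟨a, sc, h⟩ := datum_exists_member_le n D p₁ Q hP U bk b v' hbk E
    refine ⟨a, sc, h.trans (le_of_eq ?_)⟩
    have hc := card_nonGeneric_mul_of_prime n D p₁ Q U
    have hfrac : (Nat.card {u : Fin (n + 1) → ZN D p₁ Q // ¬ IsGeneric n D p₁ Q U u} : ℝ)
        / (((D * D * (p₁ * Q) : ℕ+) : ℕ) : ℝ) ^ (n + 1) = 1 / (((Q : ℕ+) : ℕ) : ℝ) ^ U.card := by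
      rw [div_eq_div_iff (by positivity) (by positivity), one_mul, ← Nat.cast_pow, ← Nat.cast_pow,
        ← Nat.cast_mul, hc]
    rw [hfrac, mul_one_div]
    push_cast
    ring
  · rw [datumReadout_weight n D p₁ Q hP U bk b v' hb hbkU hbk hunit, Complex.ofReal_re]

end Readout

end Literature.Computability.Cryptography.Chen2024

/-! ### The `Steps` rendering: T12 for every admissible shape -/

namespace Literature.Computability.Cryptography.Chen2024.Shape

open scoped BigOperators ComplexOrder
open Matrix

variable (S : Shape)

/-- For an admissible shape and `U ∌ 0`, the public vector of eq. (12) has a unit head: `bk₀ = b₀ = −1`.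
[cite: ChenQuantumLattice2024, eq. (12) p. 17] -/
theorem Admissible.exists_unit_coord {S : Shape} (h : S.Admissible) {U : Finset (Fin (S.n + 1))}
    (hU : (0 : Fin (S.n + 1)) ∉ U) {bk : Fin (S.n + 1) → ℤ} (hbk : ∀ i, i ∉ U → bk i = S.b i) :
    ∃ i₀, i₀ ∉ U ∧ IsUnit ((bk i₀ : ℤ) : ZQ S.Q) :=
  ⟨0, hU, by rw [hbk 0 hU, h.b_head]; push_cast; exact isUnit_one.neg⟩

/-- For an admissible shape and `U ∌ 0`, the unknown coordinates of `S.b` are `≡ 0 (mod p₁)` (eq. (12):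
`2p₁ ∣ b_i`, `i ≠ 0`). [cite: ChenQuantumLattice2024, eq. (12) p. 17] -/
theorem Admissible.p₁_dvd_of_mem {S : Shape} (h : S.Admissible) {U : Finset (Fin (S.n + 1))}
    (hU : (0 : Fin (S.n + 1)) ∉ U) : ∀ i ∈ U, ((S.p₁ : ℕ) : ℤ) ∣ S.b i := fun i hi =>
  (Dvd.intro_left _ rfl : ((S.p₁ : ℕ) : ℤ) ∣ 2 * (S.p₁ : ℤ)).trans (h.b_tail i fun h0 => hU (h0 ▸ hi))

/-- **T12 for every admissible shape.**  Let `U ∌ 0` be the unknown coordinates, `bk` any PUBLIC vector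
agreeing with `S.b` off `U` and `≡ 0 (mod p₁)` on `U` (e.g. zeros there), `v′` any representative of the
offset class.  The datum read-out built from `(U, bk, v′)` outputs the datum `a` on EVERY member
`(a, (s, c))` of the class with Born weight exactly `(1/Q + (1 − 1/Q)/Q^{#U})·P·N^{n+1}`.
[cite: ChenQuantumLattice2024, §3.5.9 pp. 35–37, eq. (12) p. 17, Cond. C.3 p. 18] -/
theorem datum_privacy_attained (h : S.Admissible) (U : Finset (Fin (S.n + 1)))
    (hU : (0 : Fin (S.n + 1)) ∉ U) (bk : Fin (S.n + 1) → ℤ)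
    (hbkU : ∀ i ∈ U, ((S.p₁ : ℕ) : ℤ) ∣ bk i) (hbk : ∀ i, i ∉ U → bk i = S.b i)
    (v' : Fin (S.n + 1) → ℤ) (a : ZQ S.Q) (sc : (Fin (S.n + 1) → ZQ S.Q) × (Fin (S.n + 1) → ZQ S.Q)) :
    (datumReadout S.n S.D S.p₁ S.Q h.odd_P U bk v' (h.exists_unit_coord hU hbk)).weight
        (datumKet S.n S.D S.p₁ S.Q U bk S.b v' a sc) a
      = (((1 / (S.Q : ℕ) + (1 - 1 / (S.Q : ℕ)) / ((S.Q : ℕ) : ℝ) ^ U.card)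
          * (((S.P : ℕ) : ℝ) * ((S.N : ℕ) : ℝ) ^ (S.n + 1)) : ℝ) : ℂ) :=
  datumReadout_weight S.n S.D S.p₁ S.Q h.odd_P U bk S.b v' (h.p₁_dvd_of_mem hU) hbkU hbk
    (h.exists_unit_coord hU hbk) a sc

/-- **T10 is sharp for every admissible shape with `Q` prime.**  `1/Q + (1 − 1/Q)/Q^{#U}` is the greatest
class success probability over ALL measurements of the Step-9 register (`U ∌ 0`, `bk` public as above).
[cite: ChenQuantumLattice2024, §3.5.9 pp. 35–37, eq. (12) p. 17, Cond. C.3 p. 18] -/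
theorem datum_privacy_sharp_of_prime (h : S.Admissible) [Fact (Nat.Prime (S.Q : ℕ))]
    (U : Finset (Fin (S.n + 1))) (hU : (0 : Fin (S.n + 1)) ∉ U) (bk : Fin (S.n + 1) → ℤ)
    (hbkU : ∀ i ∈ U, ((S.p₁ : ℕ) : ℤ) ∣ bk i) (hbk : ∀ i, i ∉ U → bk i = S.b i)
    (v' : Fin (S.n + 1) → ℤ) :
    IsGreatest (Set.range fun E : POVM (Fin (S.n + 1) → ZN S.D S.p₁ S.Q) (ZQ S.Q) =>
        (∑ a, ∑ sc, E.weight (datumKet S.n S.D S.p₁ S.Q U bk S.b v' a sc) a).re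
          / (∑ a : ZQ S.Q, ∑ sc, star (datumKet S.n S.D S.p₁ S.Q U bk S.b v' a sc)
              ⬝ᵥ datumKet S.n S.D S.p₁ S.Q U bk S.b v' a sc).re)
      (1 / (S.Q : ℕ) + (1 - 1 / (S.Q : ℕ)) / ((S.Q : ℕ) : ℝ) ^ U.card) :=
  datum_success_prob_isGreatest_of_prime S.n S.D S.p₁ S.Q h.odd_P U bk S.b v' (h.p₁_dvd_of_mem hU) hbkU
    hbk (h.exists_unit_coord hU hbk)

end Literature.Computability.Cryptography.Chen2024.Shape
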